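import Literature.NumberTheory.LFunctions.ThetaChainCheck
import HarnessLib

/-!
# Nicolas's inequality at the primorials `p#`, `p < 599²`, by kernel computation: the checker
# (discharge of `Literature.NumberTheory.LFunctions.nicolas_iff`, Nicolas 1983, Thm. 2 (a))

Topic: `Literature/NumberTheory/LFunctions`. The computable core of a kernel certificate for
**Nicolas's inequality** `e^γ log log N_k < N_k/φ(N_k)` at every primorial `N_k = p#` with
`p < 599² = 358801` (Nicolas 1983, Thm. 2 (a): under RH it holds at every `N_k`; the analytic
argument of the tree, `NicolasLogfUpperRH.lean`, covers `p ≥ 599²`, and below that the inequality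
is a finite, RH-free statement — Nicolas 1983/2012 likewise settle small `k` by computation). It is a
variant of the `θ`-chain of `ThetaChainCheck.lean` (same prime table `ChainTable.table`, same
primality test `ThetaChain.primeChk`, same logarithm enclosures `ThetaChain.logNext`): a state
`⟨p, Llo, Lhi, Thi, P⟩` records the prime `p` reached, `Llo ≤ 2⁸⁰ log p ≤ Lhi`, `2⁸⁰ θ(p) ≤ Thi` and
`P ≤ 2⁸⁰ ∏_{q ≤ p} q/(q−1) = 2⁸⁰ N/φ(N)`; a step to the next table entry `p'` certifies its primality,
updates `Thi' = Thi + Lhi'`, `P' = ⌊P p'/(p'−1)⌋`, and performs the comparison `nicolasChk`: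

  `GHI · (Lhi'·p' + Thi') < (P' + GHI) · p' · 2⁸⁰`,  `GHI = ⌈1.7810726 · 2⁸⁰⌉ ≥ 2⁸⁰ e^γ`,

i.e. `e^γ (log p' + θ(p')/p' − 1) < ∏_{q ≤ p'} q/(q−1)`, which implies Nicolas's inequality at `p'#`
because `log θ(p') ≤ log p' + θ(p')/p' − 1` (`log y ≤ y − 1`) — see `NicolasChainSound.lean`
(`nicolasChk_sound`, the invariant, `runDN_sound`); the run is `NicolasChainRun.lean`, the assembly
`NicolasCriterionProofs.lean`. All arithmetic is on `ℕ` with the kernel's GMP-accelerated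
primitives. Nothing is asserted: the `def`s are computable functions and two constants.

## References

* J.-L. Nicolas, *Petites valeurs de la fonction d'Euler*, J. Number Theory 17 (1983), 375–388,
  Thm. 2 (a). [Nicolas1983]
* J.-L. Nicolas, *Small values of the Euler function and the Riemann hypothesis*, Acta Arith. 155
  (2012), 311–321, Thm. 1.1 (1.7) (the computation of `c(N_k)` for `k ≤ k₀ = π(10⁹)`, §4).
  [Nicolas2012]
-/

namespace Literature.NumberTheory.LFunctions.NicolasChain

open ChainCheck ChainTable ThetaChain

/-- `GHI = ⌈1.7810726 · 2⁸⁰⌉`, an integer upper bound for `2⁸⁰ e^γ` (`e^γ = 1.78107241799…`).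
[folklore] -/
def GHI : ℕ := 2153184652748158582229784

/-- `nicolasChk p Lhi Thi P`: the test `GHI·(Lhi·p + Thi) < (P + GHI)·p·2⁸⁰`, i.e.
`(GHI/2⁸⁰)(Lhi/2⁸⁰ + Thi/(2⁸⁰ p) − 1) < P/2⁸⁰`; with `Lhi ≥ 2⁸⁰ log p`, `Thi ≥ 2⁸⁰ θ(p)`,
`P ≤ 2⁸⁰ ∏_{q ≤ p} q/(q−1)` it implies `e^γ log θ(p) < ∏_{q ≤ p} q/(q−1)` (`nicolasChk_sound`).
[cite: Nicolas1983, Thm. 2 (a)] -/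
def nicolasChk (p Lhi Thi P : ℕ) : Bool :=
  Nat.blt (Nat.mul GHI (Nat.add (Nat.mul Lhi p) Thi)) (Nat.mul (Nat.mul (Nat.add P GHI) p) SC)

/-- A state of the Nicolas chain (the data of the certificate for Nicolas's inequality at `p#`):
the prime `p` reached, `Llo ≤ 2⁸⁰ log p ≤ Lhi`, `2⁸⁰ θ(p) ≤ Thi`, `P ≤ 2⁸⁰ ∏_{q ≤ p} q/(q−1)`.
[cite: Nicolas1983, Thm. 2 (a)] -/
structure NS where
  /-- the last prime reached -/
  p : ℕ
  /-- lower bound of `2⁸⁰ log p` -/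
  Llo : ℕ
  /-- upper bound of `2⁸⁰ log p` -/
  Lhi : ℕ
  /-- upper bound of `2⁸⁰ θ(p)` -/
  Thi : ℕ
  /-- lower bound of `2⁸⁰ ∏_{q ≤ p} q/(q−1)` -/
  P : ℕ
  deriving Repr, DecidableEq

/-- **One step** of the Nicolas chain, to the next table entry `p'`: order, parity and primality of
`p'` (`ThetaChain.primeChk`); the new enclosures (`ThetaChain.logNext`, `Thi' = Thi + Lhi'`,
`P' = ⌊P·p'/(p'−1)⌋`); the comparison `nicolasChk` at `p'`. [folklore] -/
def stepN (s : NS) (p' : ℕ) : Option NS :=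
  match s with
  | ⟨p, Llo, Lhi, Thi, P⟩ =>
    bif !(Nat.blt p p' && Nat.beq (Nat.mod p' 2) 1 && primeChk p') then none else
    match logNext p Llo Lhi p' with
    | none => none
    | some (Llo', Lhi') =>
      let Thi' := Nat.add Thi Lhi'
      let P' := Nat.div (Nat.mul P p') (Nat.sub p' 1)
      bif nicolasChk p' Lhi' Thi' P' then some ⟨p', Llo', Lhi', Thi', P'⟩ else none

/-- Run over a segment of the table with fuel (a chunk): stops successfully when the fuel or the
segment is exhausted, fails as soon as a step fails. [folklore] -/
def runN : ℕ → NS → List ℕ → Option NS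
  | 0, s, _ => some s
  | _ + 1, s, [] => some s
  | fuel + 1, s, p' :: rest =>
    match stepN s p' with
    | none => none
    | some s' => runN fuel s' rest

/-- The initial state: `p = 2`, `θ(2) = log 2` (`ChainCheck.L2LON ≤ 2⁸⁰ log 2 ≤ ChainCheck.L2HIN`),
`∏_{q ≤ 2} q/(q−1) = 2` (`P = 2·2⁸⁰`). [folklore] -/
def initN : NS := ⟨2, L2LON, L2HIN, L2HIN, Nat.mul 2 SC⟩

/-- **A chunk of the run**: at most `fuel` entries of `ChainTable.table` after the state's prime.
[folklore] -/
def runDN (fuel : ℕ) (s : NS) : Option NS := runN fuel s (ChainCheck.after s.p table)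

end Literature.NumberTheory.LFunctions.NicolasChain
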